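import Mathlib
import Summits.AtomisticToContinuum.Crystallization.Theses.ChartedPlanarOrder
import Literature.MathematicalPhysics.StatisticalMechanics.LennardJonesClusters
import Literature.MathematicalPhysics.StatisticalMechanics.LocalMatchingCompactness
import Literature.Geometry.DiscreteGeometry.TwoShellPatterns
import Summits.AtomisticToContinuum.Crystallization.Theorems.HullMinimalityLayeredWindowsGoodRegionDense
import Summits.AtomisticToContinuum.Crystallization.Theorems.HullMinimalityLayeredWindowsPatternCovering

/-!
# Clean balls ⟹ a CLEAN Delone hull point (`stub_cleanHullPoint` of crux `ChartedPlanarOrder.CleanBallPlanarOrder`)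

Route `ChartedPlanarOrder` (cell decomp-a2c, lens-3), crux `CleanBallPlanarOrder` (stmt-AtomisticToContinuum-32136),
registered skeleton v3, stub E₁ `stub_cleanHullPoint` — PROVED here, statement verbatim:
if `x N` are Lennard-Jones ground states and, for every radius `ρ`, frequently in `N` some particle's `ρ`-ball
is all `(1/20, 47/50, 1)`-two-shell good, then some uniformly separated, relatively dense `X ⊆ ℝ³` is a hull
point of the sequence (two-way `ε`-matched on every ball by a translate of `x N`, frequently in `N`) and EVERY
point of `X` is `(1/16, 9/10, 1)`-two-shell good in `X`.

Proof.  (1) Uniform separation `δ = 1/3` of ground states (`LennardJonesMinimalDistance_holds`); (2) diagonal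
choice of indices `φ n` and centres `c n` with all-good `n`-balls, recentred point sets `Ys n`; (3) compactness
in the local matching topology (`exists_subseq_forall_eventually_ballMatch`, [BaakeGrimm2013, Rem. 5.6]) gives
a `δ`-separated limit `Y` two-way matched along a subsequence; (4) relative denseness of `Y` from the landed
`LayeredWindowsLocal.stub_goodRegionDense` + `stub_patternCovering` (all-good regions are `r₀`-dense);
(5) the hull property is the matching read through the translations `t = -x (φ (ψ k)) (c (ψ k))`;
(6) CLEANLINESS — `isTwoShellGoodSet_of_near`: two-shell goodness passes from ONE late approximant to the
limit with tolerance loss `1/20 ↦ 1/16` and window loss `[47/50,1] ↦ [9/10,1]`: keep the approximant's isometry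
and pattern, shrink its scale `a ↦ a·299/300` so that the limit window `3a'/2` sits strictly inside the finite
window `3a/2` (absorbing the matching error `2ε ≤ 1/400`), and snap the eighteen labels to `Y` (injective because
distinct labels are `δ`-apart and snaps move points by `ε < δ/4`).  No subsequence extraction of scales,
isometries or labels is needed — the tolerance loss pays for everything.

No new definitions; 0 sorry. [folklore]
-/

noncomputable section

namespace Summit.AtomisticToContinuum.Crystallization.Theorems.ChartedPlanarOrderCleanHullPoint

open Filter Topology Metric
open Literature.MathematicalPhysics.StatisticalMechanics Literature.Geometry.DiscreteGeometry

local notation "E3" => EuclideanSpace ℝ (Fin 3)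
/-! ## Two-shell goodness persists to local limits (with tolerance loss) -/

/-- Indexed goodness of particle `j` in an injective configuration `x` gives set goodness of the point
`x j - w` in the recentred point set `{x i - w}`. [folklore] -/
theorem isTwoShellGoodSet_range_sub {ε lo hi : ℝ} {N : ℕ} {x : Fin N → E3} {j : Fin N}
    (hinjx : Function.Injective x) (h : IsTwoShellGood ε lo hi x j) (w : E3) :
    IsTwoShellGoodSet ε lo hi (Set.range fun i => x i - w) (x j - w) := by
  obtain ⟨a, ha₁, ha₂, A, P, f, hP, hf, hinj, hwin⟩ := h
  refine ⟨a, ha₁, ha₂, A, P, fun v => x (f v) - w, hP, fun v hv => ⟨⟨f v, rfl⟩, ?_⟩, ?_, ?_⟩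
  · have h1 : (x (f v) - w) - (x j - w + a • A v) = x (f v) - (x j + a • A v) := by abel
    rw [dist_eq_norm, h1, ← dist_eq_norm]
    exact (hf v hv).2
  · intro v hv v' hv' hvv'
    exact hinj hv hv' (hinjx (sub_left_injective hvv'))
  · rintro y ⟨i, rfl⟩ hne hd
    have hij : i ≠ j := fun h => hne (by rw [h])
    have hd' : dist (x i) (x j) ≤ 3 / 2 * a := by
      have h1 : dist (x i - w) (x j - w) = dist (x i) (x j) := by
        rw [dist_eq_norm, dist_eq_norm]; congr 1; abel
      rwa [h1] at hd
    obtain ⟨v, hv, hfv⟩ := hwin i hij hd'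
    exact ⟨v, hv, by simp only [hfv]⟩

/-- `√2 ≤ 1.415`. -/
theorem sqrt_two_le : Real.sqrt 2 ≤ 1415 / 1000 := by
  calc Real.sqrt 2 ≤ Real.sqrt ((1415 / 1000) ^ 2) := Real.sqrt_le_sqrt (by norm_num)
    _ = 1415 / 1000 := Real.sqrt_sq (by norm_num)

/-- **Single-approximant persistence of two-shell goodness (tolerance loss `1/20 ↦ 1/16`, window
`[47/50, 1] ↦ [9/10, 1]`).**  Let `Yk`, `Y ⊆ ℝ³` be `δ`-separated, two-way `ε`-matched on the `4`-ball about
`q ∈ Y` (`0 < ε ≤ 1/800`, `4ε < δ`), and let every point of `Yk` within `ε` of `q` be `(1/20, 47/50, 1)`-good in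
`Yk`.  Then `q` is `(1/16, 9/10, 1)`-good in `Y`: take the good approximant `p` of `q`, keep its isometry and
pattern, SHRINK its scale `a ↦ a·299/300` (so that the limit window `3a'/2` sits strictly inside the finite
window `3a/2`, absorbing the matching error), and snap each label to `Y`. [folklore] -/
theorem isTwoShellGoodSet_of_near {Yk Y : Set E3} {q : E3} {δ ε : ℝ}
    (hε : 0 < ε) (hε₁ : ε ≤ 1 / 800) (hεδ : 4 * ε < δ)
    (hsepk : ∀ p ∈ Yk, ∀ p' ∈ Yk, p ≠ p' → δ ≤ dist p p')
    (hsep : ∀ p ∈ Y, ∀ p' ∈ Y, p ≠ p' → δ ≤ dist p p')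
    (hq : q ∈ Y)
    (hm₁ : ∀ s ∈ Y, dist s q ≤ 4 → ∃ a ∈ Yk, dist a s ≤ ε)
    (hm₂ : ∀ a ∈ Yk, dist a q ≤ 4 → ∃ s ∈ Y, dist a s ≤ ε)
    (hgood : ∀ p ∈ Yk, dist p q ≤ ε → IsTwoShellGoodSet (1 / 20) (47 / 50) 1 Yk p) :
    IsTwoShellGoodSet (1 / 16) (9 / 10) 1 Y q := by
  obtain ⟨p, hpY, hpq⟩ := hm₁ q hq (by rw [dist_self]; norm_num)
  obtain ⟨a, ha₁, ha₂, A, P, f, hP, hf, hinj, hwin⟩ := hgood p hpY hpq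
  have hs2 := sqrt_two_le
  -- every label lies within `4` of `q`
  have hfv_near : ∀ v ∈ P, dist (f v) q ≤ 4 := by
    intro v hv
    have h1 := (hf v hv).2
    have hnv : ‖a • A v‖ ≤ Real.sqrt 2 := by
      rw [norm_smul, LinearIsometry.norm_map, Real.norm_of_nonneg (by linarith)]
      calc a * ‖v‖ ≤ 1 * Real.sqrt 2 :=
            mul_le_mul ha₂ (norm_le_sqrt_two_of_mem_twoShellPattern hP hv) (norm_nonneg _) zero_le_one
        _ = Real.sqrt 2 := one_mul _
    have h2 : dist (p + a • A v) p = ‖a • A v‖ := by rw [dist_eq_norm, add_sub_cancel_left]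
    calc dist (f v) q ≤ dist (f v) (p + a • A v) + dist (p + a • A v) p + dist p q :=
          dist_triangle4 _ _ _ _
      _ ≤ 1 / 20 * a + Real.sqrt 2 + ε := by rw [h2]; linarith
      _ ≤ 4 := by linarith
  -- snap the labels to `Y`
  choose g hgY hgd using fun v (hv : v ∈ P) => hm₂ (f v) (hf v hv).1 (hfv_near v hv)
  set a' : ℝ := a * (299 / 300) with ha'
  refine ⟨a', by rw [ha']; linarith, by rw [ha']; linarith, A, P,
    fun v => if hv : v ∈ P then g v hv else 0, hP, fun v hv => ?_, ?_, ?_⟩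
  · -- matching of the snapped labels at the shrunken scale
    simp only [dif_pos hv]
    refine ⟨hgY v hv, ?_⟩
    have h1 := (hf v hv).2
    have h2 := hgd v hv
    have hv2 : ‖v‖ ≤ Real.sqrt 2 := norm_le_sqrt_two_of_mem_twoShellPattern hP hv
    have hA : dist (p + a • A v) (q + a' • A v) ≤ ε + a / 300 * Real.sqrt 2 := by
      have h3 : (p + a • A v) - (q + a' • A v) = (p - q) + (a - a') • A v := by rw [sub_smul]; abel
      rw [dist_eq_norm, h3]
      calc ‖(p - q) + (a - a') • A v‖ ≤ ‖p - q‖ + ‖(a - a') • A v‖ := norm_add_le _ _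
        _ ≤ ε + a / 300 * Real.sqrt 2 := by
            rw [norm_smul, LinearIsometry.norm_map, ← dist_eq_norm,
              Real.norm_of_nonneg (by rw [ha']; linarith)]
            have h4 : (a - a') * ‖v‖ ≤ a / 300 * Real.sqrt 2 := by
              rw [ha', show a - a * (299 / 300) = a / 300 by ring]
              exact mul_le_mul_of_nonneg_left hv2 (by positivity)
            linarith
    have h5 : a / 300 * Real.sqrt 2 ≤ a / 300 * (1415 / 1000) :=
      mul_le_mul_of_nonneg_left hs2 (by positivity)
    calc dist (g v hv) (q + a' • A v)
        ≤ dist (g v hv) (f v) + dist (f v) (p + a • A v) + dist (p + a • A v) (q + a' • A v) :=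
          dist_triangle4 _ _ _ _
      _ ≤ ε + 1 / 20 * a + (ε + a / 300 * Real.sqrt 2) := by rw [dist_comm] at h2; linarith
      _ ≤ 1 / 16 * a' := by rw [ha']; linarith
  · -- injectivity: distinct labels are `δ`-apart in `Yk`, their snaps `2ε < δ`-close to them
    intro v hv v' hv' hvv'
    have hvP : v ∈ P := by simpa using hv
    have hv'P : v' ∈ P := by simpa using hv'
    simp only [dif_pos hvP, dif_pos hv'P] at hvv'
    by_contra hne
    have hfne : f v ≠ f v' := fun h => hne (hinj hv hv' h)
    have hδle : δ ≤ dist (f v) (f v') := hsepk _ (hf v hvP).1 _ (hf v' hv'P).1 hfne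
    have h6 : dist (f v) (f v') ≤ ε + ε := by
      calc dist (f v) (f v') ≤ dist (f v) (g v hvP) + dist (g v hvP) (f v') := dist_triangle _ _ _
        _ ≤ ε + ε := add_le_add (hgd v hvP) (by rw [hvv', dist_comm]; exact hgd v' hv'P)
    linarith
  · -- the window clause in the limit: the shrunken window sits strictly inside the finite one
    intro y hy hyq hyd
    have hy4 : dist y q ≤ 4 := by rw [ha'] at hyd; linarith
    obtain ⟨b, hbY, hby⟩ := hm₁ y hy hy4
    have hδy : δ ≤ dist y q := hsep y hy q hq hyq
    have hbp : b ≠ p := by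
      intro hbp
      rw [hbp] at hby
      have : dist y q ≤ dist p y + dist p q := dist_triangle_left _ _ _
      linarith
    have hbd : dist b p ≤ 3 / 2 * a := by
      calc dist b p ≤ dist b y + dist y q + dist q p := dist_triangle4 _ _ _ _
        _ ≤ ε + 3 / 2 * a' + ε := by rw [dist_comm q p]; linarith
        _ ≤ 3 / 2 * a := by rw [ha']; linarith
    obtain ⟨v, hv, hfvb⟩ := hwin b hbY hbp hbd
    refine ⟨v, hv, ?_⟩
    simp only [dif_pos hv]
    by_contra hne
    have h7 := hsep _ (hgY v hv) y hy hne
    have h8 : dist (g v hv) y ≤ ε + ε := by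
      calc dist (g v hv) y ≤ dist (f v) (g v hv) + dist (f v) y := dist_triangle_left _ _ _
        _ ≤ ε + ε := by rw [hfvb]; exact add_le_add (hfvb ▸ hgd v hv) hby
    linarith

/-- **Clean balls give a CLEAN Delone hull point** (`stub_cleanHullPoint` of the registered skeleton of
`ChartedPlanarOrder.CleanBallPlanarOrder`, g6 v3, VERBATIM).  If `x N` are Lennard-Jones ground states and for every
radius `ρ`, frequently in `N`, some particle's `ρ`-ball is all two-shell good (`IsTwoShellGood (1/20) (47/50) 1`),
then some uniformly separated, relatively dense `X ⊆ ℝ³` is two-way `ε`-matched on every ball `‖·‖ ≤ R` by a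
translate of `x N`, frequently in `N`, AND every point of `X` is `(1/16, 9/10, 1)`-two-shell good in `X`.
[folklore] -/
theorem stub_cleanHullPoint : ∀ x : (N : ℕ) → (Fin N → EuclideanSpace ℝ (Fin 3)), (∀ N, Literature.MathematicalPhysics.StatisticalMechanics.IsGroundState Literature.MathematicalPhysics.StatisticalMechanics.lennardJones (x N)) → (∀ ρ : ℝ, ∃ᶠ N in Filter.atTop, ∃ i : Fin N, ∀ j : Fin N, dist (x N j) (x N i) ≤ ρ → Literature.Geometry.DiscreteGeometry.IsTwoShellGood (1 / 20) (47 / 50) 1 (x N) j) → ∃ X : Set (EuclideanSpace ℝ (Fin 3)), ((∃ δ : ℝ, 0 < δ ∧ ∀ p ∈ X, ∀ q ∈ X, p ≠ q → δ ≤ dist p q) ∧ (∃ r : ℝ, ∀ c : EuclideanSpace ℝ (Fin 3), ∃ p ∈ X, dist p c ≤ r)) ∧ (∀ R ε : ℝ, 0 < ε → ∃ᶠ N in Filter.atTop, ∃ t : EuclideanSpace ℝ (Fin 3), (∀ p ∈ X, ‖p‖ ≤ R → ∃ i : Fin N, dist (x N i + t) p ≤ ε) ∧ (∀ i : Fin N,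 ‖x N i + t‖ ≤ R → ∃ p ∈ X, dist (x N i + t) p ≤ ε)) ∧ (∀ q ∈ X, Literature.Geometry.DiscreteGeometry.IsTwoShellGoodSet (1 / 16) (9 / 10) 1 X q) := by
  intro x hx hclean
  -- uniform separation of ground states
  obtain ⟨δ, hδ, hsep⟩ := LennardJonesMinimalDistance_holds
  -- relative denseness of all-good regions
  obtain ⟨r₀, hr₀, hdense⟩ :=
    LayeredWindowsLocal.stub_goodRegionDense (2 / 11) (by norm_num) LayeredWindowsLocal.stub_patternCovering
  -- diagonal choice: for every `n`, an index `φ n` (strictly increasing) and a centre with an all-good `n`-ball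
  obtain ⟨φ, hφ, hgood⟩ := extraction_forall_of_frequently (fun n : ℕ => hclean (n : ℝ))
  choose c hc using hgood
  -- the recentred point sets
  set Ys : ℕ → Set E3 := fun n => Set.range fun j : Fin (φ n) => x (φ n) j - x (φ n) (c n) with hYs
  have hYsep : ∀ n, ∀ p ∈ Ys n, ∀ q ∈ Ys n, p ≠ q → δ ≤ dist p q := by
    intro n p hp q hq hpq
    obtain ⟨j, rfl⟩ := hp
    obtain ⟨j', rfl⟩ := hq
    have hjj' : j ≠ j' := fun h => hpq (by rw [h])
    have := hsep (φ n) (x (φ n)) (hx (φ n)) j j' hjj'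
    simpa [dist_eq_norm] using this
  -- compactness in the local matching topology
  obtain ⟨ψ, Y, hψ, hYsep', hmatch⟩ := exists_subseq_forall_eventually_ballMatch hδ Ys hYsep
  have hinjx : ∀ n, Function.Injective (x (φ n)) := by
    intro n i i' h
    by_contra hne
    have := hsep (φ n) (x (φ n)) (hx (φ n)) i i' hne
    rw [h, dist_self] at this
    linarith
  refine ⟨Y, ⟨⟨δ, hδ, hYsep'⟩, ⟨r₀ + 1, fun c₀ => ?_⟩⟩, fun R ε hε => ?_, fun q hq => ?_⟩
  · -- relative denseness: follow `c₀` back to a late approximant with a large all-good ball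
    obtain ⟨n₀, hn₀⟩ := exists_nat_ge (2 * (‖c₀‖ + r₀))
    have hev := (hmatch (‖c₀‖ + r₀) 1 one_pos).and (hψ.tendsto_atTop.eventually (eventually_ge_atTop n₀))
    obtain ⟨k, hk, hkn⟩ := hev.exists
    set n := ψ k with hn
    -- the point `c₀` in the original coordinates of the `n`-th approximant
    have hy : dist (c₀ + x (φ n) (c n)) (x (φ n) (c n)) + r₀ ≤ (n : ℝ) / 2 := by
      have h1 : dist (c₀ + x (φ n) (c n)) (x (φ n) (c n)) = ‖c₀‖ := by simp [dist_eq_norm]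
      have h2 : (n₀ : ℝ) ≤ n := by exact_mod_cast hkn
      rw [h1]; linarith
    obtain ⟨j, hj⟩ := hdense (φ n) (x (φ n)) (c n) n (hc n) (c₀ + x (φ n) (c n)) hy
    have hjY : x (φ n) j - x (φ n) (c n) ∈ Ys n := ⟨j, rfl⟩
    have hjc : dist (x (φ n) j - x (φ n) (c n)) c₀ < r₀ := by
      have : dist (x (φ n) j - x (φ n) (c n)) c₀ = dist (x (φ n) j) (c₀ + x (φ n) (c n)) := by
        simp only [dist_eq_norm]; congr 1; abel
      rw [this]; exact hj
    have hjR : dist (x (φ n) j - x (φ n) (c n)) 0 ≤ ‖c₀‖ + r₀ := by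
      rw [dist_zero_right]
      have htri : ‖x (φ n) j - x (φ n) (c n)‖ ≤ ‖c₀‖ + ‖x (φ n) j - x (φ n) (c n) - c₀‖ :=
        norm_le_norm_add_norm_sub' (x (φ n) j - x (φ n) (c n)) c₀
      rw [dist_eq_norm] at hjc
      linarith
    obtain ⟨s, hs, hds⟩ := hk.2 _ hjY hjR
    refine ⟨s, hs, ?_⟩
    calc dist s c₀ ≤ dist (x (φ n) j - x (φ n) (c n)) s + dist (x (φ n) j - x (φ n) (c n)) c₀ :=
          dist_triangle_left _ _ _
      _ ≤ 1 + r₀ := by linarith [hds, hjc.le]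
      _ = r₀ + 1 := by ring
  · -- hull property: eventually along `φ ∘ ψ`, hence frequently in `N`
    have hT : Tendsto (fun k => φ (ψ k)) atTop atTop := hφ.tendsto_atTop.comp hψ.tendsto_atTop
    refine hT.frequently ((hmatch R ε hε).mono fun k hk => ?_).frequently
    refine ⟨-x (φ (ψ k)) (c (ψ k)), fun p hp hpR => ?_, fun i hiR => ?_⟩
    · obtain ⟨a, ⟨j, rfl⟩, hja⟩ := hk.1 p hp (by rwa [dist_zero_right])
      exact ⟨j, by simpa [sub_eq_add_neg] using hja⟩
    · have hmem : x (φ (ψ k)) i - x (φ (ψ k)) (c (ψ k)) ∈ Ys (ψ k) := ⟨i, rfl⟩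
      obtain ⟨s, hs, hds⟩ := hk.2 _ hmem (by rw [dist_zero_right]; simpa [sub_eq_add_neg] using hiR)
      exact ⟨s, hs, by simpa [sub_eq_add_neg] using hds⟩
  · -- cleanliness: two-shell goodness persists to the limit (one late approximant, tolerance loss)
    set ε₀ : ℝ := min (1 / 800) (δ / 8) with hε₀
    have hε₀pos : 0 < ε₀ := lt_min (by norm_num) (by linarith)
    have hε₀1 : ε₀ ≤ 1 / 800 := min_le_left _ _
    have hε₀δ : 4 * ε₀ < δ := by have := min_le_right (1 / 800 : ℝ) (δ / 8); linarith
    obtain ⟨n₀, hn₀⟩ := exists_nat_ge (‖q‖ + 5)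
    have hev := (hmatch (‖q‖ + 4) ε₀ hε₀pos).and (hψ.tendsto_atTop.eventually (eventually_ge_atTop n₀))
    obtain ⟨k, hk, hkn⟩ := hev.exists
    set n := ψ k with hn
    refine isTwoShellGoodSet_of_near hε₀pos hε₀1 hε₀δ (hYsep n) hYsep' hq ?_ ?_ ?_
    · intro s hs hsq
      refine hk.1 s hs ?_
      rw [dist_zero_right]
      have h1 := norm_le_norm_add_norm_sub' s q
      rw [← dist_eq_norm] at h1
      linarith
    · intro a ha haq
      refine hk.2 a ha ?_
      rw [dist_zero_right]
      have h1 := norm_le_norm_add_norm_sub' a q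
      rw [← dist_eq_norm] at h1
      linarith
    · rintro p ⟨j, rfl⟩ hpq
      dsimp only at hpq
      have hjn : dist (x (φ n) j) (x (φ n) (c n)) ≤ (n : ℝ) := by
        have h1 : dist (x (φ n) j) (x (φ n) (c n)) = ‖x (φ n) j - x (φ n) (c n)‖ := dist_eq_norm _ _
        have h2 : ‖x (φ n) j - x (φ n) (c n)‖ ≤ ‖q‖ + dist (x (φ n) j - x (φ n) (c n)) q := by
          rw [dist_eq_norm]; exact norm_le_norm_add_norm_sub' _ _
        have h3 : (n₀ : ℝ) ≤ n := by exact_mod_cast hkn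
        rw [h1]; linarith
      exact isTwoShellGoodSet_range_sub (hinjx n) (hc n j hjn) (x (φ n) (c n))


end Summit.AtomisticToContinuum.Crystallization.Theorems.ChartedPlanarOrderCleanHullPoint

end
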